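import Summits.QuantumFields.BalabanUV.T4Continuum.Support.B13KPStepTermCensus
import Summits.QuantumFields.BalabanUV.T4Continuum.Support.B13KPStepTermWindowChain

/-!
# NE5 ∕ U3, route P2 — THE ARITHMETIC CENSUS of route P2's END ON THE BLOCK-CHAIN (1.26) SOCKET (skeleton `t4/skeletons/NE5-t4-ne5-p2.md`
# §6 row A5, sharpened): the census END faces of `B13KPStepTermCensus`∕`…CensusAtRate` re-run on `B13KPStepTermWindowChain` — (1.26) constant
# `2²⁰ + 1` and rate floor `144` (NE9 leaf-05's block chain, SMALLNESS.md S-B13.24) in place of `K₀(64,8) ≈ 10^{139.5}` and `64·log 162 ≈ 325.6`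

Cell `pub-balaban`, unit `b2b-balaban-t4-ne5-p2` (NE5 ∕ U3 PROVER seat P2 «polymer-activity Lipschitz ∕ Kotecký–Preiss route», lineage gen 20).
Summits-side new work (cell bookkeeping; NOT a Literature module; nothing of the manuscripts is asserted).  HONEST FRAMING: rung (B)+1 of the
FINITE-VOLUME T⁴ programme — NOT infinite volume, NOT mass gap, NOT Clay, **NOT A PROOF OF NE5** (spine 0∕9): an implication from displayed binders
over NAMED-PARAMETER cores and constants; this file only does ARITHMETIC on numeric letters.  HONEST DEPENDENCY (cell line, verbatim): continuum
YM on T⁴ ⇐ BetaPertH ∧ nine spine estimates (0/9 proved); BetaPertH ⇐ (D1) ∧ (D4) ∧ CAP+tail; G-an2-4 gates asym, D1 and NE2/3/4.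

WHAT.  `B13KPStepTermCensus.census_arith` is stated for any positive (1.26)-type constant `K` and rate floor `r₁`; here it is read at
`K := 2²⁰ + 1`, `r₁ := 144` and fed to the block-chain END faces `B13KPStepTermWindowChain.ne5_above_max_record_measOp_chain` ∕
`…ne5_at_max_record_measOp_chain`, with `ReadLip` ∕ the formats' potential weights ∕ the majorant of record derived from the B13-format letters exactly
as in `B13KPStepTermMeasurableLetters` (p215092):
* **`ne5_record_measOp_census_chain`** — `∃ C₅, NE5 (outA …) (outB …) W ϰ θ′ C₅` for EVERY `θ′ > max(θ, ω)` under the other rows' sign letters,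
  the RATE ROOM `144 + max(ϰ+1, 1) + 64 ≤ R_m` and the ONE amplitude inequality
    `A_m·(2+Λhist)·9·(2²⁰+1)·e^{64} ≤ min( e^{−5·max(ϰ+1,1)}, ρ₀(1−ω)∕(512·max(Λhist∕Λop,1)·(c+1)), (θ′−ω)∕(128·(Λhist·c+1)), E_ins∕64 )`;
* **`ne5_at_inputRate_record_measOp_census_chain`** — when `ω < θ`, the same with `θ` in place of `θ′` in the amplitude inequality gives NE5 AT W1's
  RATE `θ` ITSELF.
NUMBERS (census page): `9·(2²⁰+1)·e^{64} ≈ 10^{34.8}` versus `9·K₀(64,8)·e^{64} ≈ 10^{168.2}` for the END of record; rate room `208 + σ` versus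
`389.6 + σ` (`σ = max(ϰ+1, 1)`).  The residual `e^{64}` is the (2.30) volume constant `c₁ = 4·2⁴` of the anchored exponential norm (R-IDENT's window),
not a (1.26) constant.  Same analytic display as p215092; NOT NE5.  0 sorry; axioms ⊆ {propext, Classical.choice, Quot.sound}.
-/

noncomputable section

open MeasureTheory
open scoped BigOperators

namespace Summit.QuantumFields.BalabanUV.T4Continuum.B13KPStepTermCensusChain

open Literature.MathematicalPhysics.QuantumFieldTheory.Balaban1983to89
open Literature.MathematicalPhysics.QuantumFieldTheory.Balaban1983to89.T4OutputRate (Carriers Functional DecayBound NE5)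
open Literature.MathematicalPhysics.QuantumFieldTheory.Balaban1983to89.T4InputCauchyRateData (StepModel)
open Summit.QuantumFields.BalabanUV.T4Continuum.ActivityTermModel (TermDatum TermConsts TermFamily)
open Summit.QuantumFields.BalabanUV.T4Continuum.B13Carriers (TwoRuns)
open Summit.QuantumFields.BalabanUV.T4Continuum.B13DomainGeometryTR (domainGeometry)
open Summit.QuantumFields.BalabanUV.T4Continuum.B13InnerData (b13InnerData Bnd)
open Summit.QuantumFields.BalabanUV.T4Continuum.B13OpDatum (OpDatum Species B13Weights)
open Summit.QuantumFields.BalabanUV.T4Continuum.B13HistDatum (level136)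
open Summit.QuantumFields.BalabanUV.T4Continuum.B13HistMeasurable (MeasPotFrame B13HistM)
open Summit.QuantumFields.BalabanUV.T4Continuum.B13StepOfRecord (step outA outB assembly)
open Summit.QuantumFields.BalabanUV.T4Continuum.B13StepTermLabels (InnerLabel innerLabels)
open Summit.QuantumFields.BalabanUV.T4Continuum.B13KPStepOfRecord (inputA_KP inputB_KP)
open Summit.QuantumFields.BalabanUV.T4Continuum.B13TermData (TermCore termData)
open Summit.QuantumFields.BalabanUV.T4Continuum.B13StepOfRecordTermData (TermSlots)
open Summit.QuantumFields.BalabanUV.T4Continuum.B13OpMeasurable (measOp)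
open Summit.QuantumFields.BalabanUV.T4Continuum.B13KPStepTermLetters (G₀ termMajorant termMajorant_nonneg)
open Summit.QuantumFields.BalabanUV.T4Continuum.B13KPStepTermMeasurableLetters (hsum_termMajorant_M)
open Summit.QuantumFields.BalabanUV.T4Continuum.B13KPStepTermCensus (insertionRate_of_level_le census_arith)
open Summit.QuantumFields.BalabanUV.T4Continuum.B13KPStepTermWindowChain (ne5_above_max_record_measOp_chain
  ne5_at_max_record_measOp_chain)

variable {𝔾 : Type} [GaugeGroup 𝔾] {R : TwoRuns 𝔾} {P : MeasPotFrame R.carriers} {𝒴 : Type*} {dom : 𝒴 → R.carriers.Dom}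
  {T κ ι S Ω Ω₀ 𝒞 IOp : Type*} [MeasurableSpace Ω] [MeasurableSpace Ω₀] [Fintype ι] [Fintype κ] [DecidableEq ι] [DecidableEq κ]
  (𝔖 : TermSlots R P dom T κ ι S Ω Ω₀ 𝒞 IOp) (E₀ cB : ℝ)
  (hA : ∀ g U k, (step 𝔖.toSlots E₀ cB).opA g U k ∈ measOp T κ ι Ω 𝒴)
  (hB : ∀ g U k, (step 𝔖.toSlots E₀ cB).opB g U k ∈ measOp T κ ι Ω 𝒴)
  (𝔡 : R.carriers.Dom → InnerLabel R.carriers.Dom (Bnd R) → TermConsts)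

variable [DecidableEq 𝒞]

/-! ## §1 The letters of the B13 format (as in p215092) -/

omit [Fintype ι] [Fintype κ] [DecidableEq ι] [DecidableEq κ] [DecidableEq 𝒞] in
/-- [folklore] The majorant of record is under the (2.38)-shaped bound on every catalogue when the summed per-term majorants are (`h238`). -/
theorem termMajorant_le_of_h238 {Λop Λhist ρ₀ A_m R_m : ℝ} (W : Set (ℕ → ℝ))
    (h238 : ∀ k, ∀ Z ∈ (domainGeometry R).level k,
      ∑ ℓ ∈ innerLabels (b13InnerData R) k Z, G₀ 𝔖 𝔡 Λop Λhist ρ₀ Z ℓ ≤ A_m * Real.exp (-(R_m * R.carriers.d Z))) :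
    ∀ g ∈ W, ∀ (U : R.carriers.BgB) (k : ℕ), ∀ Z ∈ R.domAt k,
      termMajorant 𝔖 𝔡 Λop Λhist ρ₀ g U Z ≤ A_m * Real.exp (-(R_m * R.carriers.d Z)) := by
  intro g _ U k Z hZ
  have hsc : R.carriers.scale Z = k := ((domainGeometry R).mem_level Z _).1 hZ
  have h := h238 k Z hZ
  unfold termMajorant
  rw [hsc]
  exact h

omit [Fintype ι] [Fintype κ] [DecidableEq 𝒞] in
/-- [folklore] `ReadLip` of every catalogued term of record in its own scale's margins, from the B13-format letters
(`B13OpMeasurable.readLip_toTermDatum_signs`, exactly as in `B13KPStepTermMeasurableLetters`). -/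
theorem readLip_of_format_letters (hF : ∀ k, 𝔖.F k = (𝔖.G k).format) {lamR : ℝ}
    (hδ : ∀ k, ∀ Z ∈ (domainGeometry R).level k, ∀ ℓ ∈ innerLabels (b13InnerData R) k Z, (𝔖.G k).δ = (𝔡 Z ℓ).δ)
    (hvR : ∀ k, ∀ Z ∈ (domainGeometry R).level k, ∀ ℓ ∈ innerLabels (b13InnerData R) k Z, ∀ Y ∈ (𝔖.core Z ℓ).D,
      (𝔖.G k).v Y ≤ lamR * (𝔖.rHist k * (‖(𝔖.G k).τ Y‖ * level136 P.consts (R.carriers.d (dom Y)))))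
    (hκL : ∀ k, ∀ Z ∈ (domainGeometry R).level k, ∀ ℓ ∈ innerLabels (b13InnerData R) k Z, 𝔖.rOp k ≤ (𝔡 Z ℓ).κL)
    (hκA : ∀ k, ∀ Z ∈ (domainGeometry R).level k, ∀ ℓ ∈ innerLabels (b13InnerData R) k Z, 𝔖.rOp k ≤ (𝔡 Z ℓ).κA)
    (hκP : ∀ k, ∀ Z ∈ (domainGeometry R).level k, ∀ ℓ ∈ innerLabels (b13InnerData R) k Z, 𝔖.rOp k ≤ (𝔡 Z ℓ).κP)
    (hκQ : ∀ k, ∀ Z ∈ (domainGeometry R).level k, ∀ ℓ ∈ innerLabels (b13InnerData R) k Z, 𝔖.rOp k ≤ (𝔡 Z ℓ).κQ)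
    (hκR : ∀ k, ∀ Z ∈ (domainGeometry R).level k, ∀ ℓ ∈ innerLabels (b13InnerData R) k Z, 𝔖.rOp k * lamR ≤ (𝔡 Z ℓ).κR) :
    ∀ k, ∀ Z ∈ (domainGeometry R).level k, ∀ ℓ ∈ innerLabels (b13InnerData R) k Z,
      (termData 𝔖.F 𝔖.G 𝔖.rHist 𝔖.core Z ℓ).ReadLip (𝔡 Z ℓ) (𝔖.rOp (R.carriers.scale Z)) (𝔖.rHist (R.carriers.scale Z)) := by
  intro k Z hZ ℓ hℓ
  have hsc : R.carriers.scale Z = k := ((domainGeometry R).mem_level Z _).1 hZ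
  unfold termData
  rw [hsc, hF k]
  exact B13OpMeasurable.readLip_toTermDatum_signs (𝔖.core Z ℓ) (𝔖.G k) (𝔖.rHist k) (𝔡 Z ℓ) (hδ k Z hZ ℓ hℓ) (hvR k Z hZ ℓ hℓ)
    (𝔖.rOp_pos k) (𝔖.rHist_pos k) (hκL k Z hZ ℓ hℓ) (hκA k Z hZ ℓ hℓ) (hκP k Z hZ ℓ hℓ) (hκQ k Z hZ ℓ hℓ) (hκR k Z hZ ℓ hℓ)

omit [Fintype ι] [Fintype κ] [DecidableEq ι] [DecidableEq κ] [DecidableEq 𝒞] in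
/-- [folklore] In the B13 format the potential weights are constants, hence measurable in the integration point. -/
theorem format_weights_measurable (hF : ∀ k, 𝔖.F k = (𝔖.G k).format) :
    (∀ k (Y : 𝒴) (b b' : κ), Measurable fun x : Ω => (𝔖.F k).wt (.potQ x Y b b')) ∧
      ∀ k (Y : 𝒴), Measurable fun x : Ω => (𝔖.F k).wt (.potR x Y) := by
  refine ⟨fun k Y b b' => ?_, fun k Y => ?_⟩ <;>
    · simp only [hF k, B13Weights.format_wt, B13Weights.wt]; exact measurable_const

/-! ## §2 The census END faces on the block-chain socket -/

include hA hB in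
/-- [folklore] **ROUTE P2's END ON BAŁABAN's CARRIERS OF RECORD — ARITHMETIC CENSUS FORM, BLOCK-CHAIN SOCKET, at every rate `θ′ > max(θ, ω)`.**
Numeric block = the other rows' sign letters, the rate clause `θ < θ′ ∧ ω < θ′`, the RATE ROOM `144 + max(ϰ+1,1) + 64 ≤ R_m` and the ONE AMPLITUDE
INEQUALITY `A_m·(2+Λhist)·9·(2²⁰+1)·e^{64} ≤ min(e^{−5·max(ϰ+1,1)}, ρ₀(1−ω)∕(512·max(Λhist∕Λop,1)·(c+1)), (θ′−ω)∕(128·(Λhist·c+1)), E_ins∕64)`;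
analytic display as in p215092.  NOT a proof of NE5. -/
theorem ne5_record_measOp_census_chain (hT : (assembly 𝔖.toSlots).TransportReads Set.univ) {W : Set (ℕ → ℝ)}
    (hF : ∀ k, 𝔖.F k = (𝔖.G k).format) {lamR : ℝ}
    {A_m R_m E₁ Eins ϰ θ δ δ' c ω Λop Λhist ρ₀ : ℝ}
    (hadm : ∀ k, ∀ Z ∈ (domainGeometry R).level k, ∀ ℓ ∈ innerLabels (b13InnerData R) k Z, (𝔡 Z ℓ).Admissible)
    (hcore : ∀ k, ∀ Z ∈ (domainGeometry R).level k, ∀ ℓ ∈ innerLabels (b13InnerData R) k Z,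
      (termData 𝔖.F 𝔖.G 𝔖.rHist 𝔖.core Z ℓ).GeometryCore (𝔡 Z ℓ))
    (hδ : ∀ k, ∀ Z ∈ (domainGeometry R).level k, ∀ ℓ ∈ innerLabels (b13InnerData R) k Z, (𝔖.G k).δ = (𝔡 Z ℓ).δ)
    (hvR : ∀ k, ∀ Z ∈ (domainGeometry R).level k, ∀ ℓ ∈ innerLabels (b13InnerData R) k Z, ∀ Y ∈ (𝔖.core Z ℓ).D,
      (𝔖.G k).v Y ≤ lamR * (𝔖.rHist k * (‖(𝔖.G k).τ Y‖ * level136 P.consts (R.carriers.d (dom Y)))))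
    (hκL : ∀ k, ∀ Z ∈ (domainGeometry R).level k, ∀ ℓ ∈ innerLabels (b13InnerData R) k Z, 𝔖.rOp k ≤ (𝔡 Z ℓ).κL)
    (hκA : ∀ k, ∀ Z ∈ (domainGeometry R).level k, ∀ ℓ ∈ innerLabels (b13InnerData R) k Z, 𝔖.rOp k ≤ (𝔡 Z ℓ).κA)
    (hκP : ∀ k, ∀ Z ∈ (domainGeometry R).level k, ∀ ℓ ∈ innerLabels (b13InnerData R) k Z, 𝔖.rOp k ≤ (𝔡 Z ℓ).κP)
    (hκQ : ∀ k, ∀ Z ∈ (domainGeometry R).level k, ∀ ℓ ∈ innerLabels (b13InnerData R) k Z, 𝔖.rOp k ≤ (𝔡 Z ℓ).κQ)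
    (hκR : ∀ k, ∀ Z ∈ (domainGeometry R).level k, ∀ ℓ ∈ innerLabels (b13InnerData R) k Z, 𝔖.rOp k * lamR ≤ (𝔡 Z ℓ).κR)
    (hXf : ∀ Z ℓ i, Measurable fun x => (𝔖.core Z ℓ).Xf x i) (hBf : ∀ Z ℓ a, Measurable fun x => (𝔖.core Z ℓ).Bf x a)
    (h238 : ∀ k, ∀ Z ∈ (domainGeometry R).level k,
      ∑ ℓ ∈ innerLabels (b13InnerData R) k Z, G₀ 𝔖 𝔡 Λop Λhist ρ₀ Z ℓ ≤ A_m * Real.exp (-(R_m * R.carriers.d Z)))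
    (hRef : ∀ g ∈ W, ∀ (U : R.carriers.BgB) (X : R.carriers.Dom),
      ∀ Z ∈ (domainGeometry R).level (R.carriers.scale X), ∀ ℓ ∈ innerLabels (b13InnerData R) (R.carriers.scale X) Z,
        (termData 𝔖.F 𝔖.G 𝔖.rHist 𝔖.core Z ℓ).RefAt (𝔡 Z ℓ) (inputB_KP 𝔖.toSlots E₀ cB g U X))
    (hRefA : ∀ g ∈ W, ∀ (U : R.carriers.BgB) (X : R.carriers.Dom),
      ∀ Z ∈ (domainGeometry R).level (R.carriers.scale X), ∀ ℓ ∈ innerLabels (b13InnerData R) (R.carriers.scale X) Z,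
        (termData 𝔖.F 𝔖.G 𝔖.rHist 𝔖.core Z ℓ).RefAt (𝔡 Z ℓ) (inputA_KP 𝔖.toSlots E₀ cB g U X))
    (hop : (step 𝔖.toSlots E₀ cB).OperatorRate W δ θ)
    (hins : (step 𝔖.toSlots E₀ cB).InsertionRate W ϰ Eins δ' θ)
    (hunit : (step 𝔖.toSlots E₀ cB).InsScaleBound W ϰ E₁ c ω)
    (hE₁ : 0 < E₁) (hΛop : 0 < Λop) (hΛhist : 0 < Λhist) (hρ₀ : 0 < ρ₀) (hρ₁ : ρ₀ ≤ 1)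
    (hδ0 : 0 ≤ δ) (hδ' : 0 ≤ δ') (hθ : 0 ≤ θ) (hθ1 : θ < 1) (hc : 0 ≤ c) (hω : 0 < ω) (hω1 : ω < 1) (hA_m : 0 ≤ A_m)
    (hR : 144 + max (ϰ + 1) 1 + 64 ≤ R_m)
    {θ' : ℝ} (hθθ' : θ < θ') (hωθ' : ω < θ')
    (hAm : A_m * ((2 + Λhist) * 9 * (2 ^ 20 + 1) * Real.exp 64) ≤
      min (min (Real.exp (-(max (ϰ + 1) 1 * 5))) (ρ₀ * (1 - ω) / (512 * max (Λhist / Λop) 1 * (c + 1))))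
        (min ((θ' - ω) / (128 * (Λhist * c + 1))) (Eins / 64))) :
    ∃ C₅, NE5 (outA 𝔖.toSlots E₀ cB) (outB 𝔖.toSlots E₀ cB) W ϰ θ' C₅ := by
  obtain ⟨τ, σ, s, ρ₀', hτ, hσ, hs0, hrate, hsmall, hσκ, hrate', hsmall', hρ, hs, hreach, hfb, hlev⟩ :=
    census_arith (K := 2 ^ 20 + 1) (r₁ := 144) (by norm_num) hA_m hΛop hΛhist hρ₀ hρ₁ hc hω1 hωθ' hR hAm
  obtain ⟨hFQ, hFR⟩ := format_weights_measurable 𝔖 hF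
  exact ne5_above_max_record_measOp_chain 𝔖 E₀ cB hA hB 𝔡 hT hA_m hτ hσ hs0 (termMajorant_nonneg 𝔖 𝔡 hΛop hΛhist hadm)
    (termMajorant_le_of_h238 𝔖 𝔡 W h238) hrate hsmall hσκ (by linarith) hsmall' hadm hcore
    (readLip_of_format_letters 𝔖 𝔡 hF hδ hvR hκL hκA hκP hκQ hκR) hXf hBf hFQ hFR (hsum_termMajorant_M 𝔖 E₀ cB hA hB 𝔡 W) hρ₁ hRef
    hRefA hop (insertionRate_of_level_le _ hins hlev) hunit hE₁ hΛop hΛhist hρ hs hδ0 hδ' hθ hθ1 hc hω hω1 hreach (max_lt hθθ' hfb)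

include hA hB in
/-- [folklore] **… AND AT W1's INPUT RATE `θ` ITSELF, BLOCK-CHAIN SOCKET**, when the age damping is faster (`ω < θ`): the amplitude inequality read at
the rate target `θ` makes the fed-back rate `< θ` (off resonance, `max(θ, r_fb) = θ`).  NOT a proof of NE5. -/
theorem ne5_at_inputRate_record_measOp_census_chain (hT : (assembly 𝔖.toSlots).TransportReads Set.univ) {W : Set (ℕ → ℝ)}
    (hF : ∀ k, 𝔖.F k = (𝔖.G k).format) {lamR : ℝ}
    {A_m R_m E₁ Eins ϰ θ δ δ' c ω Λop Λhist ρ₀ : ℝ}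
    (hadm : ∀ k, ∀ Z ∈ (domainGeometry R).level k, ∀ ℓ ∈ innerLabels (b13InnerData R) k Z, (𝔡 Z ℓ).Admissible)
    (hcore : ∀ k, ∀ Z ∈ (domainGeometry R).level k, ∀ ℓ ∈ innerLabels (b13InnerData R) k Z,
      (termData 𝔖.F 𝔖.G 𝔖.rHist 𝔖.core Z ℓ).GeometryCore (𝔡 Z ℓ))
    (hδ : ∀ k, ∀ Z ∈ (domainGeometry R).level k, ∀ ℓ ∈ innerLabels (b13InnerData R) k Z, (𝔖.G k).δ = (𝔡 Z ℓ).δ)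
    (hvR : ∀ k, ∀ Z ∈ (domainGeometry R).level k, ∀ ℓ ∈ innerLabels (b13InnerData R) k Z, ∀ Y ∈ (𝔖.core Z ℓ).D,
      (𝔖.G k).v Y ≤ lamR * (𝔖.rHist k * (‖(𝔖.G k).τ Y‖ * level136 P.consts (R.carriers.d (dom Y)))))
    (hκL : ∀ k, ∀ Z ∈ (domainGeometry R).level k, ∀ ℓ ∈ innerLabels (b13InnerData R) k Z, 𝔖.rOp k ≤ (𝔡 Z ℓ).κL)
    (hκA : ∀ k, ∀ Z ∈ (domainGeometry R).level k, ∀ ℓ ∈ innerLabels (b13InnerData R) k Z, 𝔖.rOp k ≤ (𝔡 Z ℓ).κA)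
    (hκP : ∀ k, ∀ Z ∈ (domainGeometry R).level k, ∀ ℓ ∈ innerLabels (b13InnerData R) k Z, 𝔖.rOp k ≤ (𝔡 Z ℓ).κP)
    (hκQ : ∀ k, ∀ Z ∈ (domainGeometry R).level k, ∀ ℓ ∈ innerLabels (b13InnerData R) k Z, 𝔖.rOp k ≤ (𝔡 Z ℓ).κQ)
    (hκR : ∀ k, ∀ Z ∈ (domainGeometry R).level k, ∀ ℓ ∈ innerLabels (b13InnerData R) k Z, 𝔖.rOp k * lamR ≤ (𝔡 Z ℓ).κR)
    (hXf : ∀ Z ℓ i, Measurable fun x => (𝔖.core Z ℓ).Xf x i) (hBf : ∀ Z ℓ a, Measurable fun x => (𝔖.core Z ℓ).Bf x a)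
    (h238 : ∀ k, ∀ Z ∈ (domainGeometry R).level k,
      ∑ ℓ ∈ innerLabels (b13InnerData R) k Z, G₀ 𝔖 𝔡 Λop Λhist ρ₀ Z ℓ ≤ A_m * Real.exp (-(R_m * R.carriers.d Z)))
    (hRef : ∀ g ∈ W, ∀ (U : R.carriers.BgB) (X : R.carriers.Dom),
      ∀ Z ∈ (domainGeometry R).level (R.carriers.scale X), ∀ ℓ ∈ innerLabels (b13InnerData R) (R.carriers.scale X) Z,
        (termData 𝔖.F 𝔖.G 𝔖.rHist 𝔖.core Z ℓ).RefAt (𝔡 Z ℓ) (inputB_KP 𝔖.toSlots E₀ cB g U X))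
    (hRefA : ∀ g ∈ W, ∀ (U : R.carriers.BgB) (X : R.carriers.Dom),
      ∀ Z ∈ (domainGeometry R).level (R.carriers.scale X), ∀ ℓ ∈ innerLabels (b13InnerData R) (R.carriers.scale X) Z,
        (termData 𝔖.F 𝔖.G 𝔖.rHist 𝔖.core Z ℓ).RefAt (𝔡 Z ℓ) (inputA_KP 𝔖.toSlots E₀ cB g U X))
    (hop : (step 𝔖.toSlots E₀ cB).OperatorRate W δ θ)
    (hins : (step 𝔖.toSlots E₀ cB).InsertionRate W ϰ Eins δ' θ)
    (hunit : (step 𝔖.toSlots E₀ cB).InsScaleBound W ϰ E₁ c ω)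
    (hE₁ : 0 < E₁) (hΛop : 0 < Λop) (hΛhist : 0 < Λhist) (hρ₀ : 0 < ρ₀) (hρ₁ : ρ₀ ≤ 1)
    (hδ0 : 0 ≤ δ) (hδ' : 0 ≤ δ') (hθ : 0 ≤ θ) (hθ1 : θ < 1) (hc : 0 ≤ c) (hω : 0 < ω) (hω1 : ω < 1) (hA_m : 0 ≤ A_m)
    (hR : 144 + max (ϰ + 1) 1 + 64 ≤ R_m) (hωθ : ω < θ)
    (hAm : A_m * ((2 + Λhist) * 9 * (2 ^ 20 + 1) * Real.exp 64) ≤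
      min (min (Real.exp (-(max (ϰ + 1) 1 * 5))) (ρ₀ * (1 - ω) / (512 * max (Λhist / Λop) 1 * (c + 1))))
        (min ((θ - ω) / (128 * (Λhist * c + 1))) (Eins / 64))) :
    ∃ C₅, NE5 (outA 𝔖.toSlots E₀ cB) (outB 𝔖.toSlots E₀ cB) W ϰ θ C₅ := by
  obtain ⟨τ, σ, s, ρ₀', hτ, hσ, hs0, hrate, hsmall, hσκ, hrate', hsmall', hρ, hs, hreach, hfb, hlev⟩ :=
    census_arith (K := 2 ^ 20 + 1) (r₁ := 144) (by norm_num) hA_m hΛop hΛhist hρ₀ hρ₁ hc hω1 hωθ hR hAm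
  obtain ⟨hFQ, hFR⟩ := format_weights_measurable 𝔖 hF
  have hne : θ ≠ ω + (τ * 64 * Real.exp (-(σ * 5))) * Λhist / (s - Λhist * ρ₀') * c := ne_of_gt hfb
  have hmax : max θ (ω + (τ * 64 * Real.exp (-(σ * 5))) * Λhist / (s - Λhist * ρ₀') * c) = θ := max_eq_left hfb.le
  rw [← hmax]
  exact ne5_at_max_record_measOp_chain 𝔖 E₀ cB hA hB 𝔡 hT hA_m hτ hσ hs0 (termMajorant_nonneg 𝔖 𝔡 hΛop hΛhist hadm)
    (termMajorant_le_of_h238 𝔖 𝔡 W h238) hrate hsmall hσκ (by linarith) hsmall' hadm hcore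
    (readLip_of_format_letters 𝔖 𝔡 hF hδ hvR hκL hκA hκP hκQ hκR) hXf hBf hFQ hFR (hsum_termMajorant_M 𝔖 E₀ cB hA hB 𝔡 W) hρ₁ hRef
    hRefA hop (insertionRate_of_level_le _ hins hlev) hunit hE₁ hΛop hΛhist hρ hs hδ0 hδ' hθ hθ1 hc hω hω1 hreach hne

end Summit.QuantumFields.BalabanUV.T4Continuum.B13KPStepTermCensusChain

end
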